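import Summits.BirchSwinnertonDyer.BirchSwinnertonDyer.Theorems.SignedLowerHalvesSmallImageLowerHalfBothSignsRttD2TwistLevel
import HarnessLib

/-!
# Route `SignedLowerHalves`, crux L `SmallImageLowerHalfBothSigns` (stmt-BirchSwinnertonDyer-23599), line `rtt_w3` v14 — E2, row «D-tw-coh» part 2b:
# the level twist is conj-SEMILINEAR — `tw ∘ conj^θ_γ = (θ(γ)θ'(γ)⁻¹) · conj^{θ'}_γ ∘ tw`

INPUTS hand `bsd-inputs-honda-p1` g23 (LEAD g11 RULING «U» (U5); sequel of `…RttD2TwistLevel`, part 1a: `levelTwistO`). The level twist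
`tw : H^i(G_P(F), 𝒪 ⊗ μ_{p^k} ⊗ θ) → H^i(G_P(F), 𝒪 ⊗ μ_{p^k} ⊗ θ')` (identity on cochains, `θ' ≡ θ (mod p^k)` on `U = Gal(K̄/F)` normal in `Γ_K`) is
NOT equivariant for the conjugation action of `γ ∈ Γ_K` (`levelConjO`): the two actions of `γ` on the coefficients differ by the unit
`η(γ)⁻¹ = θ(γ)θ'(γ)⁻¹` of `𝒪`. Precisely:
* `muTwistO_eq_oMuScalar_muTwistO` — on vectors, `θ(γ) ⊗ γ = (θ(γ)θ'(γ)⁻¹ ⊗ id) ∘ (θ'(γ) ⊗ γ)`;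
* ★★ `levelTwistO_levelConjO` — **`tw (γ · y) = (θ(γ)θ'(γ)⁻¹) · (γ · tw y)`**, every degree: both sides are the map on `H^i` of ONE compatible pair
  `(c_γ : U_P → U_P; v ↦ θ(γ)·γv)` (the tree's pointwise composition `map_comp_apply_of`, three times).
Consequence for the junction (RULING «U»): under the twist the `Λ_{𝒪,2} = 𝒪⟦T₁,T₂⟧`-structures correspond SEMILINEARLY along
`(1 + T_i) ↦ η(γ_i)⁻¹ (1 + T_i)` (`η = θ'/θ`), i.e. `tw (T_i • y) = (η(γ_i)⁻¹(1 + T_i) − 1) • tw y`.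
THEOREMS only; no `def`, no named fact, no `sorry`; crux L, crux M, E2 and BSD remain OPEN and are proved for NO curve by any of this.
References: [SerreLocalFields1979] VII §5; [NeukirchSchmidtWingberg2008] I §5; [Rubin2000] Ch. VI §6.1–6.2 (twisting, `Tw_ρ`); [JohnsonLeungKings2011] §4.2.
-/

set_option autoImplicit false
-- the Theorems namespace of this sub repeats the summit name by design (D-0017 nested layout)
set_option linter.dupNamespace false

noncomputable section

open scoped NumberField TensorProduct
open CategoryTheory Field IsDedekindDomain
open Literature.NumberTheory.GaloisRepresentations
open Literature.NumberTheory.GaloisRepresentations.DiscreteGaloisModule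
open Literature.NumberTheory.EllipticCurves
open Literature.NumberTheory.ComplexMultiplication.EllipticUnits
open Literature.NumberTheory.ComplexMultiplication.EllipticUnits.JohnsonLeungKings2011

namespace Summit.BirchSwinnertonDyer.BirchSwinnertonDyer.Theorems.SmallImageRttD2Twist

-- no `[NumberField K]`: nothing here uses the arithmetic of `K` (the linter would flag it)
variable {K : Type} [Field K] {p : ℕ} [Fact p.Prime] (S : Set (PadicAlgCl p))
  (P : Set (HeightOneSpectrum (𝓞 K))) (θ θ' : absoluteGaloisGroup K →ₜ* (padicCoeffIntegers S)ˣ) (k : ℕ)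

/-- **On vectors the two twisted actions of `γ` differ by the unit `θ(γ)θ'(γ)⁻¹`**: `θ(γ) ⊗ γ = (θ(γ)θ'(γ)⁻¹ ⊗ id) ∘ (θ'(γ) ⊗ γ)` on `𝒪 ⊗ μ_{p^k}`.
[cite: JohnsonLeungKings2011, Def. 1.1 (arXiv p0005:L11–13)] [cite: Rubin2000, Ch. VI §6.1] -/
theorem muTwistO_eq_oMuScalar_muTwistO (γ : absoluteGaloisGroup K) (x : OMuCarrier K S (p ^ k)) :
    muTwistO S θ k γ x =
      oMuScalar S (p ^ k) (((θ γ * (θ' γ)⁻¹ : (padicCoeffIntegers S)ˣ)) : padicCoeffIntegers S) (muTwistO S θ' k γ x) := by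
  have hu : (((θ γ * (θ' γ)⁻¹ : (padicCoeffIntegers S)ˣ)) : padicCoeffIntegers S) * ((θ' γ : (padicCoeffIntegers S)ˣ) : padicCoeffIntegers S) =
      ((θ γ : (padicCoeffIntegers S)ˣ) : padicCoeffIntegers S) := by
    rw [← Units.val_mul, inv_mul_cancel_right]
  induction x using OMuCarrier.induction_on with
  | zero => rw [map_zero, map_zero, map_zero]
  | tmul a v => rw [muTwistO_tmul, muTwistO_tmul, oMuScalar_tmul, ← mul_assoc, hu]
  | add x y hx hy => rw [map_add, map_add, map_add, hx, hy]

variable (hN : ∀ σ ∈ ramificationSubgroup K P, ∃ b : padicCoeffIntegers S,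
    ((θ' σ : (padicCoeffIntegers S)ˣ) : padicCoeffIntegers S) = (θ σ : (padicCoeffIntegers S)ˣ) + ((p : padicCoeffIntegers S)) ^ k * b)
  (U : Subgroup (absoluteGaloisGroup K)) [U.Normal]
  (hU : ∀ σ ∈ U, ∃ b : padicCoeffIntegers S,
    ((θ' σ : (padicCoeffIntegers S)ˣ) : padicCoeffIntegers S) = (θ σ : (padicCoeffIntegers S)ˣ) + ((p : padicCoeffIntegers S)) ^ k * b)

/-- ★★ **The level twist is conj-semilinear**: `tw (γ · y) = (θ(γ)θ'(γ)⁻¹) · (γ · tw y)` on `H^i(G_P(F), 𝒪 ⊗ μ_{p^k} ⊗ θ) → H^i(G_P(F), 𝒪 ⊗ μ_{p^k} ⊗ θ')`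
for `U = Gal(K̄/F)` normal, every `γ ∈ Γ_K` and every degree `i` — `tw ∘ H^i(c_γ, θ(γ)·γ)` and `H^i(id, θ(γ)θ'(γ)⁻¹ ⊗ id) ∘ H^i(c_γ, θ'(γ)·γ) ∘ tw` are both the
map of the compatible pair `(c_γ; v ↦ θ(γ)·γv)` (pointwise composition of compatible pairs, `map_comp_apply_of`).
[cite: SerreLocalFields1979, VII §5] [cite: NeukirchSchmidtWingberg2008, I §5 Prop. 1.5.4] [cite: Rubin2000, Ch. VI §6.1–6.2] -/
theorem levelTwistO_levelConjO (γ : absoluteGaloisGroup K) (i : ℕ) (y : levelCohO S P θ U k i) :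
    levelTwistO S P θ θ' k hN U hU i (levelConjO S P θ U k i γ y) =
      levelScalarO S P θ' U k i (((θ γ * (θ' γ)⁻¹ : (padicCoeffIntegers S)ˣ)) : padicCoeffIntegers S)
        (levelConjO S P θ' U k i γ (levelTwistO S P θ θ' k hN U hU i y)) := by
  haveI : (imGS P U).Normal := normal_imGS P U
  -- the players: `g = γ|` in `G_P`, the unit `u = θ(γ)θ'(γ)⁻¹`, the twist `T`, the two conjugation halves `F, F'`, the constant `Su`,
  -- and `T` read between the `c_g`-restricted modules (`Tres`)
  let g : GaloisGroupUnramifiedOutside K P := toUnramifiedQuot K P γ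
  let u : padicCoeffIntegers S := ((θ γ * (θ' γ)⁻¹ : (padicCoeffIntegers S)ˣ))
  let T := twistLevelHomO S P θ θ' k hN U hU
  let F := conjRepHom (coeffGSO S P θ k).toTopRep (imGS P U) g
  let F' := conjRepHom (coeffGSO S P θ' k).toTopRep (imGS P U) g
  let Su := levelMapHomO S P θ' U (oMuScalar S (p ^ k) u) (oMuScalar_muTwistO S θ' k u)
  let Tres : TopRep.res (subgroupConj (imGS P U) g : ↥(imGS P U) →* ↥(imGS P U)) (subgroupRep (coeffGSO S P θ k).toTopRep (imGS P U)) ⟶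
      TopRep.res (subgroupConj (imGS P U) g : ↥(imGS P U) →* ↥(imGS P U)) (subgroupRep (coeffGSO S P θ' k).toTopRep (imGS P U)) :=
    TopRep.ofHom ⟨T.hom.toContinuousLinearMap, fun x ↦ T.hom.isIntertwining' (subgroupConj (imGS P U) g x)⟩
  -- (1) `tw ∘ conj^θ_γ = H^i(c_g, F ≫ T)`
  have h1 := map_comp_apply_of (X := subgroupRep (coeffGSO S P θ k).toTopRep (imGS P U))
    (Y := subgroupRep (coeffGSO S P θ k).toTopRep (imGS P U)) (Z := subgroupRep (coeffGSO S P θ' k).toTopRep (imGS P U))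
    (subgroupConj (imGS P U) g) (ContinuousMonoidHom.id _) (subgroupConj (imGS P U) g) (fun _ ↦ rfl) F T (F ≫ T) (fun _ ↦ rfl) i y
  -- (2) `conj^{θ'}_γ ∘ tw = H^i(c_g, Tres ≫ F')`
  have h2 := map_comp_apply_of (X := subgroupRep (coeffGSO S P θ k).toTopRep (imGS P U))
    (Y := subgroupRep (coeffGSO S P θ' k).toTopRep (imGS P U)) (Z := subgroupRep (coeffGSO S P θ' k).toTopRep (imGS P U))
    (ContinuousMonoidHom.id _) (subgroupConj (imGS P U) g) (subgroupConj (imGS P U) g) (fun _ ↦ rfl) T F' (Tres ≫ F') (fun _ ↦ rfl) i y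
  -- (3) `F ≫ T = (Tres ≫ F') ≫ Su` POINTWISE (the unit `u`), hence `H^i(c_g, F ≫ T) = H^i(id, Su) ∘ H^i(c_g, Tres ≫ F')`
  have hpt : ∀ v, (F ≫ T).hom v = Su.hom ((Tres ≫ F').hom v) := fun v ↦ by
    apply Subtype.ext
    change muTwistO S θ k γ (v : OMuCarrier K S (p ^ k)) = oMuScalar S (p ^ k) u (muTwistO S θ' k γ (v : OMuCarrier K S (p ^ k)))
    exact muTwistO_eq_oMuScalar_muTwistO S θ θ' k γ v
  have h3 := map_comp_apply_of (X := subgroupRep (coeffGSO S P θ k).toTopRep (imGS P U))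
    (Y := subgroupRep (coeffGSO S P θ' k).toTopRep (imGS P U)) (Z := subgroupRep (coeffGSO S P θ' k).toTopRep (imGS P U))
    (subgroupConj (imGS P U) g) (ContinuousMonoidHom.id _) (subgroupConj (imGS P U) g) (fun _ ↦ rfl) (Tres ≫ F') Su (F ≫ T) hpt i y
  rw [h2] at h3
  exact h1.symm.trans h3

end Summit.BirchSwinnertonDyer.BirchSwinnertonDyer.Theorems.SmallImageRttD2Twist

end
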